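import Literature.Analysis.Calculus.EnergyTailCutoff
import Literature.Analysis.Calculus.HardyChainHalfLine
import HarnessLib

/-!
# Logarithmic-scale cutoffs and the Hardy bound for their layer cost

Analysis/Calculus support file (everything proved, no definitions).

* `exists_logScaleCutoff` — there is an absolute constant `C ≥ 0` such that for all `0 < R₀ < R₁`
  there is a smooth `χ : ℝ → [0,1]` with `χ = 1` on `{|x| ≤ R₀}`, `χ = 0` on `{|x| ≥ R₁}` and
  `|χ′(x)| ≤ C / (log(R₁/R₀)·|x|)` for `x ≠ 0` (the profile of `EnergyTailCutoff.exists_smooth_cutoff`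
  read in the variable `log(x²/R₀²)/(2 log(R₁/R₀))`); so the transition is spread over the whole
  range `R₀ ≤ |x| ≤ R₁` and its cost against `h²` is `(C/log(R₁/R₀))² ∫ h²/x²`, small for `R₁/R₀`
  large — the substitute for "pigeonholing one dyadic layer".
* `lintegral_sq_div_sq_le_four_mul` — the two-sided Hardy bound `∫⁻ h²/x² ≤ 4 ∫⁻ h′²` (lower
  Lebesgue integrals over `ℝ`, `∞` allowed) for `h ∈ C¹` vanishing on `[−ρ, ρ]`, `ρ > 0`
  (`HardyChainHalfLine.hardy_sq_div_pow_le` with `q = 0` on each side, exhausted by monotone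
  convergence).
Used for the dyadic/large-scale splitting of finite-energy Cauchy data supported off a shell
(route PhotonSphereChannels, crux `WindowedShellChannels`, stmt-FinalStateConjecture-14085, stub
`stub_dyadicSplit`). Folklore.
-/

noncomputable section

namespace Literature.Analysis.Calculus

open Set Filter Topology MeasureTheory intervalIntegral Real
open scoped ENNReal

/-! ### The logarithmic-scale cutoff -/

/-- **Logarithmic-scale cutoffs.** See the module docstring. [folklore] -/
theorem exists_logScaleCutoff :
    ∃ C : ℝ, 0 ≤ C ∧ ∀ R₀ R₁ : ℝ, 0 < R₀ → R₀ < R₁ →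
      ∃ χ : ℝ → ℝ, ContDiff ℝ (⊤ : ℕ∞) χ ∧ (∀ x, |x| ≤ R₀ → χ x = 1) ∧ (∀ x, R₁ ≤ |x| → χ x = 0) ∧
        (∀ x, 0 ≤ χ x ∧ χ x ≤ 1) ∧
        ∀ x, x ≠ 0 → |deriv χ x| ≤ C / (Real.log (R₁ / R₀) * |x|) := by
  obtain ⟨χ₀, hχ₀C, hχ₀1, hχ₀2, hχ₀01, C, hC0, hC⟩ := exists_smooth_cutoff
  refine ⟨C, hC0, fun R₀ R₁ hR₀ hR₁ => ?_⟩
  set Λ : ℝ := Real.log (R₁ / R₀) with hΛ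
  have hΛ0 : 0 < Λ := Real.log_pos (by rw [lt_div_iff₀ hR₀]; linarith)
  -- the log variable `a(x) = log(x²/R₀²)/(2Λ) + 1`
  set a : ℝ → ℝ := fun x => Real.log (x ^ 2 / R₀ ^ 2) / (2 * Λ) + 1 with ha
  set χ : ℝ → ℝ := fun x => χ₀ (a x) with hχ
  have hR₀2 : 0 < R₀ ^ 2 := by positivity
  -- `χ = 1` on `|x| ≤ R₀`
  have hone : ∀ x, |x| ≤ R₀ → χ x = 1 := by
    intro x hx
    simp only [hχ, ha]
    refine hχ₀1 _ ?_
    have hx2 : x ^ 2 / R₀ ^ 2 ≤ 1 := by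
      rw [div_le_one hR₀2, ← sq_abs]
      exact pow_le_pow_left₀ (abs_nonneg x) hx 2
    have hlog : Real.log (x ^ 2 / R₀ ^ 2) ≤ 0 := by
      rcases eq_or_lt_of_le (div_nonneg (sq_nonneg x) hR₀2.le) with h0 | h0
      · rw [← h0, Real.log_zero]
      · exact Real.log_nonpos h0.le hx2
    have : Real.log (x ^ 2 / R₀ ^ 2) / (2 * Λ) ≤ 0 :=
      div_nonpos_of_nonpos_of_nonneg hlog (by positivity)
    linarith
  -- `χ = 0` on `|x| ≥ R₁`
  have hzero : ∀ x, R₁ ≤ |x| → χ x = 0 := by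
    intro x hx
    simp only [hχ, ha]
    refine hχ₀2 _ ?_
    have hx0 : 0 < |x| := lt_of_lt_of_le (hR₀.trans hR₁) hx
    have h1 : (R₁ / R₀) ^ 2 ≤ x ^ 2 / R₀ ^ 2 := by
      rw [div_pow, ← sq_abs x]
      exact div_le_div_of_nonneg_right (pow_le_pow_left₀ (by linarith) hx 2) hR₀2.le
    have hq : 0 < R₁ / R₀ := div_pos (hR₀.trans hR₁) hR₀
    have h2 : 2 * Λ ≤ Real.log (x ^ 2 / R₀ ^ 2) := by
      rw [hΛ, ← Real.log_rpow hq, show ((R₁ / R₀) ^ (2:ℝ)) = (R₁ / R₀) ^ 2 by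
        rw [← Real.rpow_natCast]; norm_num]
      exact Real.log_le_log (pow_pos hq 2) h1
    have : 1 ≤ Real.log (x ^ 2 / R₀ ^ 2) / (2 * Λ) := by
      rw [le_div_iff₀ (by positivity)]; linarith
    linarith
  -- smoothness
  have hsmooth_away : ∀ x, x ≠ 0 → ContDiffAt ℝ (⊤ : ℕ∞) χ x := by
    intro x hx
    have h1 : ContDiffAt ℝ (⊤ : ℕ∞) (fun y : ℝ => y ^ 2 / R₀ ^ 2) x :=
      ((contDiff_id.pow 2).div_const _).contDiffAt
    have h3 : ContDiffAt ℝ (⊤ : ℕ∞) (fun y => Real.log (y ^ 2 / R₀ ^ 2)) x :=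
      h1.log (div_ne_zero (pow_ne_zero 2 hx) hR₀2.ne')
    have h4 : ContDiffAt ℝ (⊤ : ℕ∞) a x := (h3.div_const _).add contDiffAt_const
    exact (hχ₀C.contDiffAt).comp x h4
  have hCD : ContDiff ℝ (⊤ : ℕ∞) χ := by
    refine contDiff_iff_contDiffAt.2 fun x => ?_
    by_cases hx : |x| < R₀
    · -- locally constant
      have hev : χ =ᶠ[𝓝 x] fun _ => (1 : ℝ) := by
        have ho : IsOpen {y : ℝ | |y| < R₀} := isOpen_lt continuous_abs continuous_const
        filter_upwards [ho.mem_nhds hx] with y hy using hone y (le_of_lt hy)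
      exact contDiffAt_const.congr_of_eventuallyEq hev
    · exact hsmooth_away x (by
        intro h0; apply hx; rw [h0, abs_zero]; exact hR₀)
  -- derivative bound
  have hderiv : ∀ x, x ≠ 0 → |deriv χ x| ≤ C / (Λ * |x|) := by
    intro x hx
    have hx2 : x ^ 2 / R₀ ^ 2 ≠ 0 := by positivity
    have hda : HasDerivAt a (1 / (Λ * x)) x := by
      have h1 : HasDerivAt (fun y : ℝ => y ^ 2 / R₀ ^ 2) (2 * x / R₀ ^ 2) x := by
        simpa using ((hasDerivAt_pow 2 x).div_const (R₀ ^ 2))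
      have h2 : HasDerivAt (fun y => Real.log (y ^ 2 / R₀ ^ 2)) ((2 * x / R₀ ^ 2) / (x ^ 2 / R₀ ^ 2)) x :=
        h1.log hx2
      have h3 := (h2.div_const (2 * Λ)).add_const 1
      refine h3.congr_deriv ?_
      field_simp
    have hdχ : HasDerivAt χ (deriv χ₀ (a x) * (1 / (Λ * x))) x := by
      have h0 : HasDerivAt χ₀ (deriv χ₀ (a x)) (a x) :=
        ((hχ₀C.differentiable (by simp)) (a x)).hasDerivAt
      exact h0.comp x hda
    rw [hdχ.deriv, abs_mul, abs_div, abs_one, abs_mul, abs_of_pos hΛ0]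
    calc |deriv χ₀ (a x)| * (1 / (Λ * |x|)) ≤ C * (1 / (Λ * |x|)) :=
          mul_le_mul_of_nonneg_right (hC _) (by positivity)
      _ = C / (Λ * |x|) := by ring
  exact ⟨χ, hCD, hone, hzero, fun x => hχ₀01 _, hderiv⟩

/-! ### The two-sided Hardy bound in lower Lebesgue form -/

/-- One-sided Hardy on `[ρ, X]` for `h ∈ C¹` with `h(ρ) = 0`, `ρ > 0`:
`∫_ρ^X h²/x² ≤ 4 ∫_ρ^X h′²`. [folklore] -/
theorem integral_sq_div_sq_le_right {h : ℝ → ℝ} (hh : ContDiff ℝ 1 h) {ρ X : ℝ} (hρ : 0 < ρ)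
    (hρX : ρ ≤ X) (h0 : h ρ = 0) :
    ∫ x in ρ..X, h x ^ 2 / x ^ 2 ≤ 4 * ∫ x in ρ..X, deriv h x ^ 2 := by
  have hd : ∀ r ∈ Icc ρ X, HasDerivAt h (deriv h r) r := fun r _ =>
    ((hh.differentiable (by norm_num)) r).hasDerivAt
  have hc : ContinuousOn (deriv h) (Icc ρ X) := (hh.continuous_deriv le_rfl).continuousOn
  have := hardy_sq_div_pow_le hρ hρX hd hc h0 0
  simpa using this

/-- One-sided Hardy on `[−X, −ρ]` for `h ∈ C¹` with `h(−ρ) = 0`, `ρ > 0`: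
`∫_{−X}^{−ρ} h²/x² ≤ 4 ∫_{−X}^{−ρ} h′²`. [folklore] -/
theorem integral_sq_div_sq_le_left {h : ℝ → ℝ} (hh : ContDiff ℝ 1 h) {ρ X : ℝ} (hρ : 0 < ρ)
    (hρX : ρ ≤ X) (h0 : h (-ρ) = 0) :
    ∫ x in (-X)..(-ρ), h x ^ 2 / x ^ 2 ≤ 4 * ∫ x in (-X)..(-ρ), deriv h x ^ 2 := by
  set k : ℝ → ℝ := fun y => h (-y) with hk
  have hkC : ContDiff ℝ 1 k := hh.comp contDiff_neg
  have hk0 : k ρ = 0 := by simp [hk, h0]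
  have hkd : ∀ y, deriv k y = -deriv h (-y) := by
    intro y
    simp only [hk]
    rw [deriv_comp_neg]
  have h1 := integral_sq_div_sq_le_right hkC hρ hρX hk0
  have e1 : (∫ x in ρ..X, k x ^ 2 / x ^ 2) = ∫ x in (-X)..(-ρ), h x ^ 2 / x ^ 2 := by
    have := intervalIntegral.integral_comp_neg (a := ρ) (b := X) (fun y => h y ^ 2 / y ^ 2)
    simpa only [hk, even_two.neg_pow] using this
  have e2 : (∫ x in ρ..X, deriv k x ^ 2) = ∫ x in (-X)..(-ρ), deriv h x ^ 2 := by
    have := intervalIntegral.integral_comp_neg (a := ρ) (b := X) (fun y => deriv h y ^ 2)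
    simpa only [hkd, even_two.neg_pow] using this
  rw [e1, e2] at h1
  exact h1

/-- From interval bounds to half-line lower Lebesgue integrals by exhaustion: if `f, g ≥ 0` are
continuous and `∫_a^{a+n} f ≤ c ∫_a^{a+n} g` for all `n : ℕ` (`c ≥ 0`), then
`∫⁻_{x>a} f ≤ c ∫⁻_{x>a} g`. [folklore] -/
theorem lintegral_Ioi_le_of_interval_le {f g : ℝ → ℝ} (hf : Continuous f) (hg : Continuous g)
    (hf0 : ∀ x, 0 ≤ f x) (hg0 : ∀ x, 0 ≤ g x) {a c : ℝ} (hc : 0 ≤ c)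
    (h : ∀ n : ℕ, (∫ x in a..(a + n), f x) ≤ c * ∫ x in a..(a + n), g x) :
    ∫⁻ x in Ioi a, ENNReal.ofReal (f x) ≤ ENNReal.ofReal c * ∫⁻ x in Ioi a, ENNReal.ofReal (g x) := by
  have hunion : Ioi a = ⋃ n : ℕ, Ioc a (a + n) := by
    ext x
    simp only [mem_iUnion, mem_Ioc, mem_Ioi]
    constructor
    · intro hx
      obtain ⟨n, hn⟩ := exists_nat_gt (x - a)
      exact ⟨n, hx, by linarith⟩
    · rintro ⟨n, h1, _⟩; exact h1
  have hdir : Directed (· ⊆ ·) fun n : ℕ => Ioc a (a + n) :=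
    Monotone.directed_le fun i j hij => Ioc_subset_Ioc le_rfl (by
      have : (i : ℝ) ≤ j := by exact_mod_cast hij
      linarith)
  conv_lhs => rw [hunion, setLIntegral_iUnion_of_directed _ hdir]
  refine iSup_le fun n => ?_
  have hn : a ≤ a + n := by have : (0:ℝ) ≤ n := n.cast_nonneg; linarith
  have hF : ∫⁻ x in Ioc a (a + n), ENNReal.ofReal (f x) = ENNReal.ofReal (∫ x in a..(a + n), f x) := by
    rw [integral_of_le hn, ofReal_integral_eq_lintegral_ofReal hf.integrableOn_Ioc
      (ae_restrict_of_forall_mem measurableSet_Ioc fun x _ => hf0 x)]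
  have hG : ∫⁻ x in Ioc a (a + n), ENNReal.ofReal (g x) = ENNReal.ofReal (∫ x in a..(a + n), g x) := by
    rw [integral_of_le hn, ofReal_integral_eq_lintegral_ofReal hg.integrableOn_Ioc
      (ae_restrict_of_forall_mem measurableSet_Ioc fun x _ => hg0 x)]
  calc ∫⁻ x in Ioc a (a + n), ENNReal.ofReal (f x) = ENNReal.ofReal (∫ x in a..(a + n), f x) := hF
    _ ≤ ENNReal.ofReal (c * ∫ x in a..(a + n), g x) := ENNReal.ofReal_le_ofReal (h n)
    _ = ENNReal.ofReal c * ENNReal.ofReal (∫ x in a..(a + n), g x) := ENNReal.ofReal_mul hc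
    _ = ENNReal.ofReal c * ∫⁻ x in Ioc a (a + n), ENNReal.ofReal (g x) := by rw [hG]
    _ ≤ ENNReal.ofReal c * ∫⁻ x in Ioi a, ENNReal.ofReal (g x) := by
        gcongr
        exact Ioc_subset_Ioi_self

/-- The mirror statement on `(−∞, −a)`: if `∫_{−a−n}^{−a} f ≤ c ∫_{−a−n}^{−a} g` for all `n`, then
`∫⁻_{x<−a} f ≤ c ∫⁻_{x<−a} g`. [folklore] -/
theorem lintegral_Iio_le_of_interval_le {f g : ℝ → ℝ} (hf : Continuous f) (hg : Continuous g)
    (hf0 : ∀ x, 0 ≤ f x) (hg0 : ∀ x, 0 ≤ g x) {a c : ℝ} (hc : 0 ≤ c)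
    (h : ∀ n : ℕ, (∫ x in (-a - n)..(-a), f x) ≤ c * ∫ x in (-a - n)..(-a), g x) :
    ∫⁻ x in Iio (-a), ENNReal.ofReal (f x) ≤ ENNReal.ofReal c * ∫⁻ x in Iio (-a), ENNReal.ofReal (g x) := by
  rw [setLIntegral_congr (Iio_ae_eq_Iic (μ := volume) (a := -a)),
    setLIntegral_congr (Iio_ae_eq_Iic (μ := volume) (a := -a))]
  have hunion : Iic (-a) = ⋃ n : ℕ, Ioc (-a - n) (-a) := by
    ext x
    simp only [mem_iUnion, mem_Ioc, mem_Iic]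
    constructor
    · intro hx
      obtain ⟨n, hn⟩ := exists_nat_gt (-a - x)
      exact ⟨n, by linarith, hx⟩
    · rintro ⟨n, _, h2⟩; exact h2
  have hdir : Directed (· ⊆ ·) fun n : ℕ => Ioc (-a - n) (-a) :=
    Monotone.directed_le fun i j hij => Ioc_subset_Ioc (by
      have : (i : ℝ) ≤ j := by exact_mod_cast hij
      linarith) le_rfl
  conv_lhs => rw [hunion, setLIntegral_iUnion_of_directed _ hdir]
  refine iSup_le fun n => ?_
  have hn : -a - n ≤ -a := by have : (0:ℝ) ≤ n := n.cast_nonneg; linarith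
  have hF : ∫⁻ x in Ioc (-a - n) (-a), ENNReal.ofReal (f x) = ENNReal.ofReal (∫ x in (-a - n)..(-a), f x) := by
    rw [integral_of_le hn, ofReal_integral_eq_lintegral_ofReal hf.integrableOn_Ioc
      (ae_restrict_of_forall_mem measurableSet_Ioc fun x _ => hf0 x)]
  have hG : ∫⁻ x in Ioc (-a - n) (-a), ENNReal.ofReal (g x) = ENNReal.ofReal (∫ x in (-a - n)..(-a), g x) := by
    rw [integral_of_le hn, ofReal_integral_eq_lintegral_ofReal hg.integrableOn_Ioc
      (ae_restrict_of_forall_mem measurableSet_Ioc fun x _ => hg0 x)]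
  calc ∫⁻ x in Ioc (-a - n) (-a), ENNReal.ofReal (f x) = ENNReal.ofReal (∫ x in (-a - n)..(-a), f x) := hF
    _ ≤ ENNReal.ofReal (c * ∫ x in (-a - n)..(-a), g x) := ENNReal.ofReal_le_ofReal (h n)
    _ = ENNReal.ofReal c * ENNReal.ofReal (∫ x in (-a - n)..(-a), g x) := ENNReal.ofReal_mul hc
    _ = ENNReal.ofReal c * ∫⁻ x in Ioc (-a - n) (-a), ENNReal.ofReal (g x) := by rw [hG]
    _ ≤ ENNReal.ofReal c * ∫⁻ x in Iic (-a), ENNReal.ofReal (g x) := by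
        gcongr
        exact Ioc_subset_Iic_self

/-- **Two-sided Hardy bound** (lower Lebesgue form, `∞` allowed): for `h ∈ C¹` vanishing on
`[−ρ, ρ]`, `ρ > 0`: `∫⁻_ℝ h²/x² ≤ 4 ∫⁻_ℝ h′²`. [folklore] -/
theorem lintegral_sq_div_sq_le_four_mul {h : ℝ → ℝ} (hh : ContDiff ℝ 1 h) {ρ : ℝ} (hρ : 0 < ρ)
    (h0 : ∀ x, |x| ≤ ρ → h x = 0) :
    ∫⁻ x, ENNReal.ofReal (h x ^ 2 / x ^ 2) ≤ 4 * ∫⁻ x, ENNReal.ofReal (deriv h x ^ 2) := by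
  have hcont : Continuous fun x => h x ^ 2 / x ^ 2 := by
    refine continuous_iff_continuousAt.2 fun x => ?_
    by_cases hx : x = 0
    · subst hx
      have hev : (fun x => h x ^ 2 / x ^ 2) =ᶠ[𝓝 (0:ℝ)] fun _ => (0 : ℝ) := by
        have ho : IsOpen {y : ℝ | |y| < ρ} := isOpen_lt continuous_abs continuous_const
        filter_upwards [ho.mem_nhds (by simpa using hρ)] with y hy
        rw [h0 y (le_of_lt hy)]; simp
      exact (continuousAt_const.congr hev.symm)
    · exact ((hh.continuous.pow 2).continuousAt).div ((continuous_pow 2).continuousAt)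
        (pow_ne_zero 2 hx)
  have hf0 : ∀ x, 0 ≤ h x ^ 2 / x ^ 2 := fun x => div_nonneg (sq_nonneg _) (sq_nonneg _)
  have hg : Continuous fun x => deriv h x ^ 2 := (hh.continuous_deriv le_rfl).pow 2
  have hg0 : ∀ x, 0 ≤ deriv h x ^ 2 := fun x => sq_nonneg _
  -- vanishing of the integrand on `[−ρ, ρ]`
  have hvan : ∀ x, |x| ≤ ρ → h x ^ 2 / x ^ 2 = 0 := fun x hx => by rw [h0 x hx]; simp
  -- right side
  have hR : ∫⁻ x in Ioi ρ, ENNReal.ofReal (h x ^ 2 / x ^ 2)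
      ≤ ENNReal.ofReal 4 * ∫⁻ x in Ioi ρ, ENNReal.ofReal (deriv h x ^ 2) :=
    lintegral_Ioi_le_of_interval_le hcont hg hf0 hg0 (by norm_num) fun n =>
      integral_sq_div_sq_le_right hh hρ (by have : (0:ℝ) ≤ n := n.cast_nonneg; linarith)
        (h0 ρ (by rw [abs_of_pos hρ]))
  -- left side
  have hL : ∫⁻ x in Iio (-ρ), ENNReal.ofReal (h x ^ 2 / x ^ 2)
      ≤ ENNReal.ofReal 4 * ∫⁻ x in Iio (-ρ), ENNReal.ofReal (deriv h x ^ 2) :=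
    lintegral_Iio_le_of_interval_le hcont hg hf0 hg0 (by norm_num) fun n => by
      have := integral_sq_div_sq_le_left hh hρ (X := ρ + n)
        (by have : (0:ℝ) ≤ n := n.cast_nonneg; linarith) (h0 (-ρ) (by rw [abs_neg, abs_of_pos hρ]))
      rw [show -(ρ + (n:ℝ)) = -ρ - n by ring] at this
      exact this
  -- the middle vanishes
  have hsplit : ∫⁻ x, ENNReal.ofReal (h x ^ 2 / x ^ 2)
      = ∫⁻ x in Iio (-ρ) ∪ Ioi ρ, ENNReal.ofReal (h x ^ 2 / x ^ 2) := by
    rw [← lintegral_add_compl _ (measurableSet_Iio.union measurableSet_Ioi)]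
    have : ∫⁻ x in (Iio (-ρ) ∪ Ioi ρ)ᶜ, ENNReal.ofReal (h x ^ 2 / x ^ 2) = 0 := by
      refine (setLIntegral_congr_fun (measurableSet_Iio.union measurableSet_Ioi).compl
        fun x hx => ?_).trans lintegral_zero
      simp only [mem_compl_iff, mem_union, mem_Iio, mem_Ioi, not_or, not_lt] at hx
      rw [hvan x (abs_le.2 ⟨by linarith [hx.1], hx.2⟩), ENNReal.ofReal_zero]
    rw [this, add_zero]
  have hdisj : Disjoint (Iio (-ρ)) (Ioi ρ) := by
    rw [Set.disjoint_iff]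
    intro x hx
    simp only [mem_inter_iff, mem_Iio, mem_Ioi] at hx
    linarith [hx.1, hx.2]
  rw [hsplit, lintegral_union measurableSet_Ioi hdisj]
  have e4 : (4 : ℝ≥0∞) = ENNReal.ofReal 4 := by simp
  calc (∫⁻ x in Iio (-ρ), ENNReal.ofReal (h x ^ 2 / x ^ 2) ∂volume)
        + ∫⁻ x in Ioi ρ, ENNReal.ofReal (h x ^ 2 / x ^ 2) ∂volume
      ≤ ENNReal.ofReal 4 * (∫⁻ x in Iio (-ρ), ENNReal.ofReal (deriv h x ^ 2))
        + ENNReal.ofReal 4 * (∫⁻ x in Ioi ρ, ENNReal.ofReal (deriv h x ^ 2)) := add_le_add hL hR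
    _ = ENNReal.ofReal 4 * ∫⁻ x in Iio (-ρ) ∪ Ioi ρ, ENNReal.ofReal (deriv h x ^ 2) := by
        rw [lintegral_union measurableSet_Ioi hdisj, mul_add]
    _ ≤ 4 * ∫⁻ x, ENNReal.ofReal (deriv h x ^ 2) := by
        rw [e4]
        gcongr
        exact Measure.restrict_le_self

end Literature.Analysis.Calculus
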